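import Summits.ABC.ABC.Theses.IneffectiveSubspace
import Summits.ABC.ABC.Theorems.IneffectiveSubspaceTowerFourGivesDepthCounted
import Summits.ABC.ABC.Theorems.IneffectiveSubspaceAbcGivesUniformSadic

/-!
# Stub `stub_reducedTowerIff` of line `Sketch` — crux `IneffectiveSubspace.DepthCountedABC` (stmt-ABC-14938)

THE REDUCED-TOWER NORMAL FORM: crux #5 `DepthCountedABC` of route `IneffectiveSubspace` is
*equivalent* to the route's parent crux #2 `UniformSadicTowerFour` restricted to REDUCED tower
points, i.e. positive coprime solutions of `x₁x₂²x₃³x₄⁴ + y₁y₂²y₃³y₄⁴ = z₁z₂²z₃³z₄⁴` whose `S`-free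
part of `M := ∏ xᵢyᵢzᵢ` is squarefree (`v_p(M) ≤ 1` for every `p ∉ S`):

`DepthCountedABC ↔ ∀ K, ∀ ε > 0, ∃ C > 0, ∀ S (at most K primes), ∀ reduced points,`
`  ∏ zᵢ^(i+1) < C · ((∏_{p ∈ S} p) · {M}^S)^(1+ε)`, with the `S`-free part
`{M}^S = ∏_{p ∈ M.primeFactors \ S} p^{v_p(M)}`.

* `→` (read a reduced point as a triple).  Put `a = ∏ xᵢ^(i+1)`, `b = ∏ yᵢ^(i+1)`,
  `c = ∏ zᵢ^(i+1)`: an abc triple with `v_p(abc) = Σᵢ (i+1)·v_p(xᵢyᵢzᵢ) ≤ 4 · v_p(M)`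
  (`reducedTower_factorization_le`).  Off `S` reducedness gives `v_p(abc) ≤ 4 < 5`, so the deep
  primes `{p : v_p(abc) ≥ 5}` all lie in `S` (`reducedTower_deep_subset`) and the triple sits in the
  cell `ω₅(abc) ≤ |S| ≤ K`; the crux gives `c < C · rad(abc)^(1+ε)`, and
  `rad(abc) ≤ (∏_{p ∈ S} p) · {M}^S` (`AbcGivesUniformSadic.rad_le_sadic`, landed) finishes by
  monotonicity of `t ↦ C · t^(1+ε)`.
* `←` (optimal lifts — the route's dictionary `towerFourGivesDepthCounted_proof` plus one extra
  discharge).  For an abc triple of the cell lift `a, b, c` optimally to level `4`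
  (`TowerFourGivesDepthCounted.exists_lift`: `v_p(∏ xᵢ) = ⌈v_p(a)/4⌉`, …) and take `S := D`, the
  deep primes of `abc`.  Then `v_p(M) = ⌈v_p(abc)/4⌉` (`reducedTower_factorization_lift`), which
  is `≤ 1` off `D` — the lifted point IS reduced (`reducedTower_reduced_of_lift`) — and
  `(∏_{p ∈ D} p) · {M}^D = rad(abc)` on the nose (`reducedTower_sadic_eq_radical`).

Hence cruxes #2 and #5 of the route differ EXACTLY by reducedness of the tower point.

Sources: statement and argument are ideator 2's `ReducedTowerIff` / `ReducedUSTF`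
(`Cruxes/DepthCountedABC/SketchIdeator2.lean`, planner-cruxidea-stmt-ABC-14938-2-0); skeleton
`Cruxes/DepthCountedABC/Lines/Sketch.lean` of lead `prover-line-stmt-ABC-14938-0` (stub
`stub_reducedTowerIff`).  The `←` bookkeeping is adapted from
`Theorems/IneffectiveSubspaceTowerFourGivesDepthCounted.lean` (support `TowerFourGivesDepthCounted`,
Vojta 2000 §3.1 lifts at level `4`), whose `TowerFourGivesDepthCounted.exists_lift` and
`TowerFourGivesDepthCounted.factorization_eq_zero_or` are called by name; the `→` radical bound
is `AbcGivesUniformSadic.rad_le_sadic` (`Theorems/IneffectiveSubspaceAbcGivesUniformSadic.lean`)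
and the identity `abc = ∏ (xᵢyᵢzᵢ)^(i+1)` is `AbcGivesTower.prod_pow_mul_three`
(`Theorems/IneffectiveSubspaceAbcGivesTower.lean`).  Mathlib only otherwise
(`Nat.factorization_prod`, `Nat.factorization_mul`, `Nat.factorization_pow`,
`Nat.support_factorization`, `Nat.radical_eq_prod_primeFactors`, `Finset.prod_sdiff`,
`Finset.card_le_card`).  Deliberately NOT here: either crux itself, and the unrestricted
implication `DepthCountedABC → UniformSadicTowerFour` (not claimed: a non-reduced point read as a
triple may leave the cell `ω₅ ≤ K`).
-/

-- `Summit.<Summit>.<Problem>` is the mandated summit-side namespace (CONVENTIONS §2); for the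
-- single-conjunct summit `ABC` the two coincide, so the duplicate `ABC.ABC` is deliberate.
set_option linter.dupNamespace false

namespace Summit.ABC.ABC.Theorems.DepthCountedABC

open scoped BigOperators
open Literature.NumberTheory.DiophantineGeometry

/-! ## `→`: a reduced point read as a triple lies in the cell `ω₅ ≤ |S|` -/

/-- Weighted versus plain valuation of a tower coordinate vector: for `w : Fin n → ℕ` with nonzero
entries, `v_p(∏ᵢ wᵢ^(i+1)) = Σᵢ (i+1)·v_p(wᵢ) ≤ n · Σᵢ v_p(wᵢ) = n · v_p(∏ᵢ wᵢ)` (each weight is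
`i + 1 ≤ n`). [folklore] -/
theorem reducedTower_factorization_prod_pow_le {n : ℕ} (w : Fin n → ℕ) (hw : ∀ i, w i ≠ 0)
    (p : ℕ) : (∏ i, w i ^ (i.val + 1)).factorization p ≤ n * (∏ i, w i).factorization p := by
  have h1 : (∏ i, w i ^ (i.val + 1)).factorization = ∑ i, (w i ^ (i.val + 1)).factorization :=
    Nat.factorization_prod fun i _ => pow_ne_zero _ (hw i)
  have h2 : (∏ i, w i).factorization = ∑ i, (w i).factorization :=
    Nat.factorization_prod fun i _ => hw i
  rw [h1, h2, Finsupp.finsetSum_apply, Finsupp.finsetSum_apply, Finset.mul_sum]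
  refine Finset.sum_le_sum fun i _ => ?_
  rw [Nat.factorization_pow, Finsupp.smul_apply, smul_eq_mul]
  exact Nat.mul_le_mul_right _ i.isLt

/-- For a tower point with positive entries, `v_p(abc) ≤ n · v_p(∏ xᵢyᵢzᵢ)`, where
`a = ∏ xᵢ^(i+1)`, `b = ∏ yᵢ^(i+1)`, `c = ∏ zᵢ^(i+1)` (so that `abc = ∏ (xᵢyᵢzᵢ)^(i+1)`).
[folklore] -/
theorem reducedTower_factorization_le {n : ℕ} (x y z : Fin n → ℕ)
    (hpos : ∀ i, 0 < x i ∧ 0 < y i ∧ 0 < z i) (p : ℕ) :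
    ((∏ i, x i ^ (i.val + 1)) * (∏ i, y i ^ (i.val + 1)) *
        (∏ i, z i ^ (i.val + 1))).factorization p ≤
      n * (∏ i, x i * y i * z i).factorization p := by
  rw [AbcGivesTower.prod_pow_mul_three]
  exact reducedTower_factorization_prod_pow_le _
    (fun i => (Nat.mul_pos (Nat.mul_pos (hpos i).1 (hpos i).2.1) (hpos i).2.2).ne') p

/-- A REDUCED level-4 point lies in the cell `ω₅ ≤ |S|`: if `v_p(∏ xᵢyᵢzᵢ) ≤ 1` for every `p ∉ S`,
then every prime at depth `≥ 5` in `abc = (∏ xᵢ^(i+1))(∏ yᵢ^(i+1))(∏ zᵢ^(i+1))` belongs to `S`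
(off `S`, `v_p(abc) ≤ 4 · v_p(∏ xᵢyᵢzᵢ) ≤ 4`). [folklore] -/
theorem reducedTower_deep_subset (x y z : Fin 4 → ℕ) (hpos : ∀ i, 0 < x i ∧ 0 < y i ∧ 0 < z i)
    (S : Finset ℕ) (hred : ∀ p ∉ S, (∏ i, x i * y i * z i).factorization p ≤ 1) :
    (((∏ i, x i ^ (i.val + 1)) * (∏ i, y i ^ (i.val + 1)) *
        (∏ i, z i ^ (i.val + 1))).primeFactors.filter fun p => 5 ≤
          ((∏ i, x i ^ (i.val + 1)) * (∏ i, y i ^ (i.val + 1)) *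
            (∏ i, z i ^ (i.val + 1))).factorization p) ⊆ S := by
  intro p hp
  by_contra hpS
  have h5 := (Finset.mem_filter.mp hp).2
  have h4 := reducedTower_factorization_le x y z hpos p
  have h1 := hred p hpS
  omega

/-! ## `←`: optimal level-4 lifts with `S :=` the deep primes are reduced points -/

/-- Valuations of a lifted triple: if `a, b, c` are nonzero and pairwise coprime and `X, Y, Z` are
nonzero with `v_p(X) = ⌈v_p(a)/4⌉`, `v_p(Y) = ⌈v_p(b)/4⌉`, `v_p(Z) = ⌈v_p(c)/4⌉` for every `p`, then
`v_p(XYZ) = ⌈v_p(abc)/4⌉` (at each prime at most one of the three valuations is nonzero).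
[folklore] -/
theorem reducedTower_factorization_lift {a b c X Y Z : ℕ} (ha : a ≠ 0) (hb : b ≠ 0) (hc : c ≠ 0)
    (hX : X ≠ 0) (hY : Y ≠ 0) (hZ : Z ≠ 0) (hab : Nat.Coprime a b) (hac : Nat.Coprime a c)
    (hbc : Nat.Coprime b c) (hXf : ∀ p, X.factorization p = (a.factorization p + 3) / 4)
    (hYf : ∀ p, Y.factorization p = (b.factorization p + 3) / 4)
    (hZf : ∀ p, Z.factorization p = (c.factorization p + 3) / 4) (p : ℕ) :
    (X * Y * Z).factorization p = ((a * b * c).factorization p + 3) / 4 := by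
  -- adapted from `Theorems/IneffectiveSubspaceTowerFourGivesDepthCounted.lean` (`hPfac` there)
  rw [Nat.factorization_mul (mul_ne_zero hX hY) hZ, Nat.factorization_mul hX hY,
    Nat.factorization_mul (mul_ne_zero ha hb) hc, Nat.factorization_mul ha hb]
  simp only [Finsupp.add_apply, hXf, hYf, hZf]
  rcases TowerFourGivesDepthCounted.factorization_eq_zero_or hab p with h1 | h1 <;>
  rcases TowerFourGivesDepthCounted.factorization_eq_zero_or hac p with h2 | h2 <;>
  rcases TowerFourGivesDepthCounted.factorization_eq_zero_or hbc p with h3 | h3 <;>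
  omega

/-- If `v_p(M) = ⌈v_p(N)/4⌉` for every `p`, then `M` and `N` have the same prime factors.
[folklore] -/
theorem reducedTower_primeFactors_eq {M N : ℕ}
    (hMN : ∀ p, M.factorization p = (N.factorization p + 3) / 4) :
    M.primeFactors = N.primeFactors := by
  ext p
  rw [← Nat.support_factorization, ← Nat.support_factorization, Finsupp.mem_support_iff,
    Finsupp.mem_support_iff, hMN]
  constructor <;> intro h <;> omega

/-- If `v_p(M) = ⌈v_p(N)/4⌉` for every `p`, then off the deep primes `D = {p : v_p(N) ≥ 5}` of `N`
one has `v_p(M) ≤ 1`: the optimal level-4 lift of a triple is a REDUCED tower point for `S := D`.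
[folklore] -/
theorem reducedTower_reduced_of_lift {M N : ℕ}
    (hMN : ∀ p, M.factorization p = (N.factorization p + 3) / 4) :
    ∀ p ∉ N.primeFactors.filter (fun p => 5 ≤ N.factorization p), M.factorization p ≤ 1 := by
  intro p hp
  rw [hMN]
  have h5 : ¬ 5 ≤ N.factorization p := fun h5 => hp (Finset.mem_filter.mpr
    ⟨by rw [← Nat.support_factorization]; exact Finsupp.mem_support_iff.mpr (by omega), h5⟩)
  omega

/-- If `v_p(M) = ⌈v_p(N)/4⌉` for every `p` and `D = {p : v_p(N) ≥ 5}` is the set of deep primes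
of `N`, then `(∏_{p ∈ D} p) · ∏_{p ∈ M.primeFactors \ D} p^{v_p(M)} = radical N` on the nose: off
`D` the exponent `v_p(M)` is `1`, and `M.primeFactors = N.primeFactors`. [folklore] -/
theorem reducedTower_sadic_eq_radical {M N : ℕ}
    (hMN : ∀ p, M.factorization p = (N.factorization p + 3) / 4) :
    (∏ p ∈ N.primeFactors.filter (fun p => 5 ≤ N.factorization p), p) *
        ∏ p ∈ M.primeFactors \ N.primeFactors.filter (fun p => 5 ≤ N.factorization p),
          p ^ M.factorization p =
      UniqueFactorizationMonoid.radical N := by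
  have hpf := reducedTower_primeFactors_eq hMN
  have hDsub : N.primeFactors.filter (fun p => 5 ≤ N.factorization p) ⊆ M.primeFactors := by
    rw [hpf]; exact Finset.filter_subset _ _
  have h1 : ∏ p ∈ M.primeFactors \ N.primeFactors.filter (fun p => 5 ≤ N.factorization p),
      p ^ M.factorization p =
      ∏ p ∈ M.primeFactors \ N.primeFactors.filter (fun p => 5 ≤ N.factorization p), p := by
    refine Finset.prod_congr rfl fun p hp => ?_
    obtain ⟨hpM, hpD⟩ := Finset.mem_sdiff.mp hp
    have hle := reducedTower_reduced_of_lift hMN p hpD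
    have hne : M.factorization p ≠ 0 :=
      Finsupp.mem_support_iff.mp (by rwa [Nat.support_factorization])
    rw [show M.factorization p = 1 by omega, pow_one]
  rw [h1, mul_comm, Finset.prod_sdiff hDsub, hpf, Nat.radical_eq_prod_primeFactors]

/-! ## The stub -/

/-- **Stub `stub_reducedTowerIff` (the REDUCED-TOWER NORMAL FORM) of line `Sketch`, crux
`DepthCountedABC` (stmt-ABC-14938).**  Crux #5 `DepthCountedABC` (abc with constant `C(K, ε)` on the
cells `ω₅(abc) ≤ K`) is equivalent to the parent crux #2 `UniformSadicTowerFour` restricted to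
REDUCED level-4 tower points (`v_p(∏ xᵢyᵢzᵢ) ≤ 1` for `p ∉ S`): `→` by reading a reduced point
as a triple of the cell `ω₅ ≤ |S| ≤ K` with `rad(abc) ≤ (∏_{p ∈ S} p) · {∏ xᵢyᵢzᵢ}^S`; `←` by
optimal level-4 lifts with `S :=` the deep primes, which are reduced and have
`(∏_{p ∈ S} p) · {∏ xᵢyᵢzᵢ}^S = rad(abc)`.  So cruxes #2 and #5 differ exactly by reducedness of
the tower point (observation of ideator 2, `Cruxes/DepthCountedABC/SketchIdeator2.lean`,
`ReducedTowerIff`, planner-cruxidea-stmt-ABC-14938-2-0). [folklore] -/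
theorem stub_reducedTowerIff :
    Summit.ABC.ABC.Theses.IneffectiveSubspace.DepthCountedABC ↔
    (∀ K : ℕ, ∀ ε : ℝ, 0 < ε → ∃ C : ℝ, 0 < C ∧ ∀ S : Finset ℕ, S.card ≤ K → (∀ p ∈ S, Nat.Prime p) →
      ∀ x y z : Fin 4 → ℕ, (∀ i, 0 < x i ∧ 0 < y i ∧ 0 < z i) →
        (∀ p ∉ S, (∏ i, x i * y i * z i).factorization p ≤ 1) →
        (∏ i, x i ^ (i.val + 1)) + (∏ i, y i ^ (i.val + 1)) = ∏ i, z i ^ (i.val + 1) →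
        Nat.Coprime (∏ i, x i ^ (i.val + 1)) (∏ i, y i ^ (i.val + 1)) →
          ((∏ i, z i ^ (i.val + 1) : ℕ) : ℝ) <
            C * (((∏ p ∈ S, p) * ∏ p ∈ (∏ i, x i * y i * z i).primeFactors \ S,
              p ^ (∏ i, x i * y i * z i).factorization p : ℕ) : ℝ) ^ (1 + ε)) := by
  unfold Summit.ABC.ABC.Theses.IneffectiveSubspace.DepthCountedABC
  refine ⟨fun h K ε hε => ?_, fun h K ε hε => ?_⟩
  · -- `→`: a reduced point read as a triple lies in the cell `ω₅ ≤ |S| ≤ K`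
    obtain ⟨C, hC, hh⟩ := h K ε hε
    refine ⟨C, hC, fun S hSK hS x y z hpos hred hsum hcop => ?_⟩
    have ha : 0 < ∏ i, x i ^ (i.val + 1) := Finset.prod_pos fun i _ => pow_pos (hpos i).1 _
    have hb : 0 < ∏ i, y i ^ (i.val + 1) := Finset.prod_pos fun i _ => pow_pos (hpos i).2.1 _
    have htriple :
        IsABCTriple (∏ i, x i ^ (i.val + 1)) (∏ i, y i ^ (i.val + 1)) (∏ i, z i ^ (i.val + 1)) :=
      ⟨ha, hb, hsum, hcop⟩
    have hK := (Finset.card_le_card (reducedTower_deep_subset x y z hpos S hred)).trans hSK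
    have hrad :
        ((rad (∏ i, x i ^ (i.val + 1)) (∏ i, y i ^ (i.val + 1)) (∏ i, z i ^ (i.val + 1)) : ℕ) : ℝ) ≤
          (((∏ p ∈ S, p) * ∏ p ∈ (∏ i, x i * y i * z i).primeFactors \ S,
            p ^ (∏ i, x i * y i * z i).factorization p : ℕ) : ℝ) := by
      exact_mod_cast AbcGivesUniformSadic.rad_le_sadic x y z hpos S hS
    calc ((∏ i, z i ^ (i.val + 1) : ℕ) : ℝ)
        < C * ((rad (∏ i, x i ^ (i.val + 1)) (∏ i, y i ^ (i.val + 1))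
            (∏ i, z i ^ (i.val + 1)) : ℕ) : ℝ) ^ (1 + ε) := hh _ _ _ htriple hK
      _ ≤ C * (((∏ p ∈ S, p) * ∏ p ∈ (∏ i, x i * y i * z i).primeFactors \ S,
            p ^ (∏ i, x i * y i * z i).factorization p : ℕ) : ℝ) ^ (1 + ε) := by
        gcongr
  · -- `←`: optimal level-4 lifts with `S :=` the deep primes are reduced points
    obtain ⟨C, hC, hTow⟩ := h K ε hε
    refine ⟨C, hC, fun a b c habc hK => ?_⟩
    obtain ⟨ha, hb, hsum, hcop⟩ := habc
    have hc : 0 < c := by omega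
    have hac : Nat.Coprime a c := by
      rw [← hsum]; exact Nat.coprime_self_add_right.mpr hcop
    have hbc : Nat.Coprime b c := by
      rw [← hsum]; exact Nat.coprime_add_self_right.mpr hcop.symm
    obtain ⟨x, hx0, hxa, hxf⟩ := TowerFourGivesDepthCounted.exists_lift ha.ne'
    obtain ⟨y, hy0, hyb, hyf⟩ := TowerFourGivesDepthCounted.exists_lift hb.ne'
    obtain ⟨z, hz0, hzc, hzf⟩ := TowerFourGivesDepthCounted.exists_lift hc.ne'
    -- valuations of the lifted point: `v_p(∏ xᵢyᵢzᵢ) = ⌈v_p(abc)/4⌉`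
    have hPfac : ∀ p, (∏ i, x i * y i * z i).factorization p =
        ((a * b * c).factorization p + 3) / 4 := by
      intro p
      rw [Finset.prod_mul_distrib, Finset.prod_mul_distrib]
      exact reducedTower_factorization_lift ha.ne' hb.ne' hc.ne'
        (Finset.prod_pos fun i _ => hx0 i).ne' (Finset.prod_pos fun i _ => hy0 i).ne'
        (Finset.prod_pos fun i _ => hz0 i).ne' hcop hac hbc hxf hyf hzf p
    -- the deep primes are primes
    have hDprime : ∀ p ∈ (a * b * c).primeFactors.filter (fun p => 5 ≤ (a * b * c).factorization p),
        p.Prime := fun p hp => Nat.prime_of_mem_primeFactors (Finset.mem_filter.mp hp).1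
    -- feed the (reduced!) lifted point to the reduced tower, `S :=` the deep primes
    have key := hTow _ hK hDprime x y z (fun i => ⟨hx0 i, hy0 i, hz0 i⟩)
      (reducedTower_reduced_of_lift hPfac) (by rw [hxa, hyb, hzc]; exact hsum)
      (by rw [hxa, hyb]; exact hcop)
    rw [hzc, reducedTower_sadic_eq_radical hPfac, ← rad_def] at key
    exact key

end Summit.ABC.ABC.Theorems.DepthCountedABC
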